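import Literature.Barriers.CriticalPhenomena.LongRangeTrivialityOnZ3
import Literature.Probability.LatticeModels.SharpnessSubcritical
import Mathlib.Analysis.SumIntegralComparisons
import Mathlib.Analysis.SpecialFunctions.Integrals.Basic

/-!
# Lattice sums on `ℤ³` for the bound on `S(β,L,f)`: spheres of the supremum norm, power sums, and the
# two estimates `∑_{x∈Λ_L∖0}|x|^{-(1+η)} ≲ L^{2-η}`, `∑_{|x|>M}|x|^{-q} ≲ M^{3-q}`

Sibling of `Literature/Barriers/CriticalPhenomena/LongRangeTrivialityOnZ3.lean` (barrier catalogue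
D-0021, sub-problem `Ising3DConformalLimit`); a toolkit file for `LongRangeTrivialityOnZ3UrsellSum.lean`,
which formalises page 22 of Panis 2023 (arXiv:2309.05797, proof of Theorem 5.5) on `ℤ³`. That page uses
two lattice sums without comment: `χ_L(β) ≤ C₄L^{2-η}` (from `⟨σ₀σ_x⟩ ≤ 𝐂|x|^{-(d-2+η)}`, i.e.
`∑_{x∈Λ_L∖0}|x|_∞^{-(d-2+η)} ≲ L^{2-η}`) and `∑_{x∉Λ_{M}}|x|^{-q} ≲ M^{d-q}` for `q > d`. Here `d = 3`,
on top of the tree's integer sup norm `Site.supNorm` and spheres `sphere d k = {|u|_∞ = k}` of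
`Literature.Probability.LatticeModels.SharpnessProofs` (`mem_box_iff_supNorm_le`, `Site.norm_eq_supNorm`,
`sphere_succ_eq_sdiff`, `card_sphere_succ_add`, `Site.supNorm_neg`, `Site.supNorm_le_supNorm_sub_add`):

* `card_sphere_three_le`: `|∂Λ_k| = (2k+1)³ - (2k-1)³ = 24k² + 2 ≤ 26k²` in `ℤ³` (`k ≥ 1`; sharper than
  the general `card_sphere_succ_le`);
* the radial summation formula in `Ioc` form, `sum_box_sdiff_eq_sum_sphere`
  (`∑_{u∈Λ_N∖Λ_M} g(|u|_∞) = ∑_{k=M+1}^{N}|∂Λ_k| g(k)`, no hypothesis `M ≤ N`; the `Ico`/`k+1` form is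
  `Literature.Barriers.CriticalPhenomena.sum_box_sdiff_box_eq_sum_Ico` of `LaceExpansionHighDimensionProofs`);
* power sums by comparison with `∫ t^{-p}` (Mathlib's `AntitoneOn.sum_le_integral_Ico`, `integral_rpow`):
  `∑_{k=M+1}^{N} k^{-p} ≤ M^{1-p}/(p-1)` (`p > 1`; `sum_Ioc_rpow_neg_le` — the same statement is proved in
  `Literature/NumberTheory/Sieve/GoldstonPintzYildirimEulerProduct.lean`; a local copy is kept rather
  than a cross-topic import), `∑_{k=1}^{n} k^{-s} ≤ n^{1-s}/(1-s)` (`0 ≤ s < 1`), `∑_{k=1}^{n} k^{1-η} ≤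
  (1+1/(2-η)) n^{2-η}` (`η < 2`);
* the two `ℤ³` estimates: `sum_box_rpow_supNorm_le` (`∑_{x∈Λ_L∖Λ_0}|x|_∞^{-(1+η)} ≤ 26(1+1/(2-η))L^{2-η}`)
  and `sum_box_sdiff_rpow_supNorm_le` (`∑_{u∈Λ_N∖Λ_M}|u|_∞^{-q} ≤ 26M^{3-q}/(q-3)`, `q > 3`, uniformly in `N`).

## References

* R. Panis, arXiv:2309.05797 (2023) = Ann. Probab. 54 (2026), proof of Theorem 5.5, p. 22
  [Panis2023Triviality].
-/

noncomputable section

namespace Literature.Barriers.CriticalPhenomena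

open Literature.Probability.LatticeModels Literature.Probability.Percolation Filter Topology Finset

namespace LongRangeIsing

variable {d : ℕ}

/-! ### Spheres in `ℤ³`; radial summation -/

section Spheres

/-- In `ℤ³`, `|∂Λ_k| ≤ 26 k²` for `k ≥ 1` (`(2k+1)³ - (2k-1)³ = 24k² + 2`). [folklore] -/
theorem card_sphere_three_le {k : ℕ} (hk : 1 ≤ k) : (#(sphere 3 k) : ℝ) ≤ 26 * (k : ℝ) ^ 2 := by
  obtain ⟨j, rfl⟩ : ∃ j, k = j + 1 := ⟨k - 1, by omega⟩
  have h := card_sphere_succ_add (d := 3) j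
  rw [card_box, card_box] at h
  have h' : (#(sphere 3 (j + 1)) : ℝ) = ((2 * (j + 1) + 1) ^ 3 : ℕ) - ((2 * j + 1) ^ 3 : ℕ) := by
    rw [eq_sub_iff_add_eq]
    exact_mod_cast h
  rw [h']
  push_cast
  nlinarith [sq_nonneg (j : ℝ), Nat.cast_nonneg (α := ℝ) j]

/-- **Summing a radial function over spheres** (`Ioc` form, no hypothesis on `M, N`):
`∑_{u ∈ Λ_N ∖ Λ_M} g(|u|_∞) = ∑_{k=M+1}^{N} |∂Λ_k| g(k)`. The `Ico` form (`|∂Λ_{k+1}| g(k+1)`, `M ≤ N`) is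
`Literature.Barriers.CriticalPhenomena.sum_box_sdiff_box_eq_sum_Ico`. [folklore] -/
theorem sum_box_sdiff_eq_sum_sphere (g : ℕ → ℝ) (M N : ℕ) :
    ∑ u ∈ box d N \ box d M, g (Site.supNorm u) = ∑ k ∈ Finset.Ioc M N, (#(sphere d k) : ℝ) * g k := by
  have hmaps : ∀ u ∈ box d N \ box d M, Site.supNorm u ∈ Finset.Ioc M N := by
    intro u hu
    rw [Finset.mem_sdiff, mem_box_iff_supNorm_le, mem_box_iff_supNorm_le] at hu
    rw [Finset.mem_Ioc]
    omega
  rw [← Finset.sum_fiberwise_of_maps_to hmaps]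
  refine Finset.sum_congr rfl fun k hk => ?_
  rw [Finset.mem_Ioc] at hk
  have hfib : (box d N \ box d M).filter (fun u => Site.supNorm u = k) = sphere d k := by
    ext u
    rw [Finset.mem_filter, Finset.mem_sdiff, mem_box_iff_supNorm_le, mem_box_iff_supNorm_le, mem_sphere]
    omega
  rw [hfib, Finset.sum_congr rfl fun u hu => by rw [mem_sphere.1 hu], Finset.sum_const, nsmul_eq_mul]

end Spheres

/-! ### Power sums: `∑_{k ≤ n} k^{-s}` and tails `∑_{k > M} k^{-p}` -/

section PowerSums

/-- `∑_{k=a+1}^{b} k^{-p} ≤ ∫_a^b t^{-p} dt` for `1 ≤ a ≤ b`, `p ≥ 0`. [folklore] -/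
theorem sum_Ioc_rpow_neg_le_integral {p : ℝ} (hp : 0 ≤ p) {a b : ℕ} (ha : 1 ≤ a) (hab : a ≤ b) :
    ∑ k ∈ Finset.Ioc a b, (k : ℝ) ^ (-p) ≤ ∫ t in (a : ℝ)..b, t ^ (-p) := by
  have hanti : AntitoneOn (fun t : ℝ => t ^ (-p)) (Set.Icc (a : ℝ) b) := by
    intro x hx y hy hxy
    have hx0 : 0 < x := lt_of_lt_of_le (by exact_mod_cast ha) hx.1
    exact Real.rpow_le_rpow_of_nonpos hx0 hxy (by linarith)
  have h := AntitoneOn.sum_le_integral_Ico hab hanti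
  have heq : ∑ k ∈ Finset.Ioc a b, (k : ℝ) ^ (-p) = ∑ i ∈ Finset.Ico a b, ((i + 1 : ℕ) : ℝ) ^ (-p) := by
    have himage : Finset.Ioc a b = (Finset.Ico a b).image (· + 1) := by
      ext k
      simp only [Finset.mem_Ioc, Finset.mem_image, Finset.mem_Ico]
      constructor
      · intro hk
        exact ⟨k - 1, by omega, by omega⟩
      · rintro ⟨i, hi, rfl⟩
        omega
    rw [himage, Finset.sum_image fun i _ j _ h => by omega]
  rw [heq]
  exact h

/-- **Tail of a `p`-series**: for `p > 1` and `M ≥ 1`, `∑_{k=M+1}^{N} k^{-p} ≤ M^{1-p}/(p-1)` (any `N`;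
the sum is empty for `N ≤ M`). Also proved, for the Sieve topic, in
`Literature/NumberTheory/Sieve/GoldstonPintzYildirimEulerProduct.lean`. [folklore] -/
theorem sum_Ioc_rpow_neg_le {p : ℝ} (hp : 1 < p) {M : ℕ} (hM : 1 ≤ M) (N : ℕ) :
    ∑ k ∈ Finset.Ioc M N, (k : ℝ) ^ (-p) ≤ (M : ℝ) ^ (1 - p) / (p - 1) := by
  have hM0 : (0 : ℝ) < M := by exact_mod_cast hM
  rcases le_or_gt N M with hNM | hMN
  · rw [Finset.Ioc_eq_empty (by omega), Finset.sum_empty]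
    exact div_nonneg (Real.rpow_nonneg hM0.le _) (by linarith)
  have hN0 : (0 : ℝ) < N := by exact_mod_cast (lt_of_lt_of_le hM hMN.le)
  refine (sum_Ioc_rpow_neg_le_integral (by linarith) hM hMN.le).trans ?_
  have h0 : (0 : ℝ) ∉ Set.uIcc (M : ℝ) N := by
    rw [Set.uIcc_of_le (by exact_mod_cast hMN.le)]
    intro h
    exact absurd h.1 (not_le.2 hM0)
  rw [integral_rpow (Or.inr ⟨by linarith, h0⟩)]
  have hp1 : -p + 1 = 1 - p := by ring
  rw [hp1]
  have hNp : 0 ≤ (N : ℝ) ^ (1 - p) := Real.rpow_nonneg hN0.le _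
  calc ((N : ℝ) ^ (1 - p) - (M : ℝ) ^ (1 - p)) / (1 - p)
      = ((M : ℝ) ^ (1 - p) - (N : ℝ) ^ (1 - p)) / (p - 1) := by
        rw [div_eq_div_iff (by linarith) (by linarith)]
        ring
    _ ≤ (M : ℝ) ^ (1 - p) / (p - 1) := div_le_div_of_nonneg_right (by linarith) (by linarith)

/-- `∑_{k=1}^{n} k^{-s} ≤ n^{1-s}/(1-s)` for `0 ≤ s < 1`, `n ≥ 1`. [folklore] -/
theorem sum_Icc_rpow_neg_le {s : ℝ} (hs0 : 0 ≤ s) (hs1 : s < 1) {n : ℕ} (hn : 1 ≤ n) :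
    ∑ k ∈ Finset.Icc 1 n, (k : ℝ) ^ (-s) ≤ (n : ℝ) ^ (1 - s) / (1 - s) := by
  have hn0 : (0 : ℝ) < n := by exact_mod_cast hn
  have hsplit : ∑ k ∈ Finset.Icc 1 n, (k : ℝ) ^ (-s) = 1 + ∑ k ∈ Finset.Ioc 1 n, (k : ℝ) ^ (-s) := by
    have h1 : Finset.Icc 1 n = insert 1 (Finset.Ioc 1 n) := by
      ext k
      simp only [Finset.mem_Icc, Finset.mem_insert, Finset.mem_Ioc]
      omega
    rw [h1, Finset.sum_insert (by simp), Nat.cast_one, Real.one_rpow]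
  rw [hsplit]
  have h2 := sum_Ioc_rpow_neg_le_integral hs0 le_rfl hn
  have h0 : (0 : ℝ) ∉ Set.uIcc ((1 : ℕ) : ℝ) n := by
    rw [Set.uIcc_of_le (by exact_mod_cast hn)]
    intro h
    exact absurd h.1 (by norm_num)
  rw [integral_rpow (Or.inr ⟨by linarith, h0⟩), Nat.cast_one, Real.one_rpow] at h2
  have hp1 : -s + 1 = 1 - s := by ring
  rw [hp1] at h2
  have h1s : 0 < 1 - s := by linarith
  have h3 : (1 : ℝ) ≤ 1 / (1 - s) := by
    rw [le_div_iff₀ h1s]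
    linarith
  calc 1 + ∑ k ∈ Finset.Ioc 1 n, (k : ℝ) ^ (-s) ≤ 1 + ((n : ℝ) ^ (1 - s) - 1) / (1 - s) := by linarith
    _ = (n : ℝ) ^ (1 - s) / (1 - s) + (1 - 1 / (1 - s)) := by ring
    _ ≤ (n : ℝ) ^ (1 - s) / (1 - s) := by linarith

/-- `∑_{k=1}^{n} k^{1-η} ≤ (1 + 1/(2-η)) n^{2-η}` for `η < 2`, `n ≥ 1` (for `η ≤ 1` each term is at
most `n^{1-η}`; for `η > 1` the previous lemma with `s = η - 1`). [folklore] -/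
theorem sum_Icc_rpow_one_sub_le {η : ℝ} (hη2 : η < 2) {n : ℕ} (hn : 1 ≤ n) :
    ∑ k ∈ Finset.Icc 1 n, (k : ℝ) ^ (1 - η) ≤ (1 + 1 / (2 - η)) * (n : ℝ) ^ (2 - η) := by
  have hn0 : (0 : ℝ) < n := by exact_mod_cast hn
  have hnp : 0 < (n : ℝ) ^ (2 - η) := Real.rpow_pos_of_pos hn0 _
  have h2η : 0 < 2 - η := by linarith
  rcases le_or_gt η 1 with hle | hgt
  · -- each term ≤ n^{1-η}, and there are `n` terms
    have hterm : ∀ k ∈ Finset.Icc 1 n, (k : ℝ) ^ (1 - η) ≤ (n : ℝ) ^ (1 - η) := by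
      intro k hk
      rw [Finset.mem_Icc] at hk
      exact Real.rpow_le_rpow (by positivity) (by exact_mod_cast hk.2) (by linarith)
    calc ∑ k ∈ Finset.Icc 1 n, (k : ℝ) ^ (1 - η) ≤ ∑ _k ∈ Finset.Icc 1 n, (n : ℝ) ^ (1 - η) :=
          Finset.sum_le_sum hterm
      _ = (n : ℝ) * (n : ℝ) ^ (1 - η) := by rw [Finset.sum_const, Nat.card_Icc, nsmul_eq_mul]; push_cast; ring_nf
      _ = (n : ℝ) ^ (2 - η) := by
          rw [show (2 : ℝ) - η = 1 + (1 - η) by ring, Real.rpow_add hn0, Real.rpow_one]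
      _ ≤ (1 + 1 / (2 - η)) * (n : ℝ) ^ (2 - η) := by
          have : 0 ≤ 1 / (2 - η) := by positivity
          nlinarith
  · have h := sum_Icc_rpow_neg_le (s := η - 1) (by linarith) (by linarith) hn
    have e1 : ∀ k : ℕ, (k : ℝ) ^ (-(η - 1)) = (k : ℝ) ^ (1 - η) := fun k => by rw [neg_sub]
    simp_rw [e1] at h
    rw [show (1 : ℝ) - (η - 1) = 2 - η by ring] at h
    calc ∑ k ∈ Finset.Icc 1 n, (k : ℝ) ^ (1 - η) ≤ (n : ℝ) ^ (2 - η) / (2 - η) := h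
      _ = 1 / (2 - η) * (n : ℝ) ^ (2 - η) := by ring
      _ ≤ (1 + 1 / (2 - η)) * (n : ℝ) ^ (2 - η) := by nlinarith

end PowerSums

/-! ### The two lattice sums of the proof of Theorem 5.5 in `ℤ³` -/

section LatticeSumsZ3

/-- **`∑_{x ∈ Λ_L ∖ Λ_0} |x|_∞^{-(1+η)} ≤ 26(1 + 1/(2-η)) L^{2-η}` in `ℤ³`** (`η < 2`, `L ≥ 1`): spheres
of size `≤ 26k²` and `∑_{k ≤ L} k^{1-η}`. This is the estimate behind "`χ_L(β) ≤ C₄L^{2-η}`" in the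
bound on (1), p. 22 of the source. [cite: Panis2023Triviality, proof of Theorem 5.5, bound on (1) ("χ_L(β) ≤ C_4 L^{2-η}"), p. 22] -/
theorem sum_box_rpow_supNorm_le {η : ℝ} (hη2 : η < 2) {L : ℕ} (hL : 1 ≤ L) :
    ∑ u ∈ box 3 L \ box 3 0, ((Site.supNorm u : ℝ)) ^ (-(1 + η)) ≤
      26 * (1 + 1 / (2 - η)) * (L : ℝ) ^ (2 - η) := by
  rw [sum_box_sdiff_eq_sum_sphere (fun k => ((k : ℝ)) ^ (-(1 + η))) 0 L]
  have hIoc : Finset.Ioc 0 L = Finset.Icc 1 L := by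
    ext k
    simp only [Finset.mem_Ioc, Finset.mem_Icc]
    omega
  rw [hIoc]
  have hterm : ∀ k ∈ Finset.Icc 1 L, (#(sphere 3 k) : ℝ) * ((k : ℝ)) ^ (-(1 + η)) ≤ 26 * (k : ℝ) ^ (1 - η) := by
    intro k hk
    rw [Finset.mem_Icc] at hk
    have hk0 : (0 : ℝ) < k := by exact_mod_cast hk.1
    calc (#(sphere 3 k) : ℝ) * ((k : ℝ)) ^ (-(1 + η)) ≤ 26 * (k : ℝ) ^ 2 * ((k : ℝ)) ^ (-(1 + η)) :=
          mul_le_mul_of_nonneg_right (card_sphere_three_le hk.1) (Real.rpow_nonneg hk0.le _)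
      _ = 26 * (k : ℝ) ^ (1 - η) := by
          rw [mul_assoc, show ((k : ℝ)) ^ (2 : ℕ) = (k : ℝ) ^ (2 : ℝ) by norm_cast, ← Real.rpow_add hk0]
          ring_nf
  calc ∑ k ∈ Finset.Icc 1 L, (#(sphere 3 k) : ℝ) * ((k : ℝ)) ^ (-(1 + η))
      ≤ ∑ k ∈ Finset.Icc 1 L, 26 * (k : ℝ) ^ (1 - η) := Finset.sum_le_sum hterm
    _ = 26 * ∑ k ∈ Finset.Icc 1 L, (k : ℝ) ^ (1 - η) := by rw [Finset.mul_sum]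
    _ ≤ 26 * ((1 + 1 / (2 - η)) * (L : ℝ) ^ (2 - η)) :=
        mul_le_mul_of_nonneg_left (sum_Icc_rpow_one_sub_le hη2 hL) (by norm_num)
    _ = 26 * (1 + 1 / (2 - η)) * (L : ℝ) ^ (2 - η) := by ring

/-- **Far tail in `ℤ³`**: for `q > 3`, `M ≥ 1` and every `N`,
`∑_{u ∈ Λ_N ∖ Λ_M} |u|_∞^{-q} ≤ 26 M^{3-q}/(q-3)` (spheres of size `≤ 26k²` and the tail of the
`(q-2)`-series). This is the estimate behind "`∑_{x∉Λ_{dr_fL}} |x|^{-(2d-4+2η)}`" in the bound on (2),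
p. 22 of the source. [cite: Panis2023Triviality, proof of Theorem 5.5, bound on (2) (last two lines), p. 22] -/
theorem sum_box_sdiff_rpow_supNorm_le {q : ℝ} (hq : 3 < q) {M : ℕ} (hM : 1 ≤ M) (N : ℕ) :
    ∑ u ∈ box 3 N \ box 3 M, ((Site.supNorm u : ℝ)) ^ (-q) ≤ 26 * (M : ℝ) ^ (3 - q) / (q - 3) := by
  rw [sum_box_sdiff_eq_sum_sphere (fun k => ((k : ℝ)) ^ (-q)) M N]
  have hterm : ∀ k ∈ Finset.Ioc M N, (#(sphere 3 k) : ℝ) * ((k : ℝ)) ^ (-q) ≤ 26 * (k : ℝ) ^ (-(q - 2)) := by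
    intro k hk
    rw [Finset.mem_Ioc] at hk
    have hk1 : 1 ≤ k := by omega
    have hk0 : (0 : ℝ) < k := by exact_mod_cast hk1
    calc (#(sphere 3 k) : ℝ) * ((k : ℝ)) ^ (-q) ≤ 26 * (k : ℝ) ^ 2 * ((k : ℝ)) ^ (-q) :=
          mul_le_mul_of_nonneg_right (card_sphere_three_le hk1) (Real.rpow_nonneg hk0.le _)
      _ = 26 * (k : ℝ) ^ (-(q - 2)) := by
          rw [mul_assoc, show ((k : ℝ)) ^ (2 : ℕ) = (k : ℝ) ^ (2 : ℝ) by norm_cast, ← Real.rpow_add hk0]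
          ring_nf
  have hq2 : 1 < q - 2 := by linarith
  calc ∑ k ∈ Finset.Ioc M N, (#(sphere 3 k) : ℝ) * ((k : ℝ)) ^ (-q)
      ≤ ∑ k ∈ Finset.Ioc M N, 26 * (k : ℝ) ^ (-(q - 2)) := Finset.sum_le_sum hterm
    _ = 26 * ∑ k ∈ Finset.Ioc M N, (k : ℝ) ^ (-(q - 2)) := by rw [Finset.mul_sum]
    _ ≤ 26 * ((M : ℝ) ^ (1 - (q - 2)) / (q - 2 - 1)) :=
        mul_le_mul_of_nonneg_left (sum_Ioc_rpow_neg_le hq2 hM N) (by norm_num)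
    _ = 26 * (M : ℝ) ^ (3 - q) / (q - 3) := by
        rw [show (1 : ℝ) - (q - 2) = 3 - q by ring, show q - 2 - 1 = q - 3 by ring]
        ring

end LatticeSumsZ3

end LongRangeIsing

end Literature.Barriers.CriticalPhenomena

end
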